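import Mathlib
import Summits.PneNP.PneNP.Theorems.OverlapGapAlgebraSolvableImpliesStableSectionMonotoneRepairLocal
import Summits.PneNP.PneNP.Theorems.OverlapGapAlgebraSolvableImpliesStableSectionTwoWayRepairDynamics

/-!
# PneNP / OverlapGapAlgebra — crux `SolvableImpliesStableSection` (stmt-PneNP-2463):
# the TWO-WAY REPAIR block (11/·) — the repair values are a bounded-radius local rule

Support for crux `stmt-PneNP-2463` (`Summit.PneNP.PneNP.Theses.OverlapGapAlgebra.SolvableImpliesStableSection`):
the f-free block "bounded-round two-way repair with one-round memory gives stable sections for every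
`ν > 0` up to `α ≤ 2^k/(4k)`".  The value of a variable `v` after `R` rounds of two-way repair
(`…TwoWayRepairDynamics`) is determined by the clauses within co-occurrence distance `R` of `v`: the
value at round `t + 1` is computed from the values at rounds `t` AND `t - 1` (one-round memory) of the
variables of the clauses containing `v` — both one step closer, so the radius still grows by one per
round.  In the hypothesis shape of the radius-`r` local-rule interface (`shwRad_hamming_le` /
`sissMV_concl_of_localMean`):

* `sissW_val_transfer` — if `Φ`, `Φ'` agree on every clause seen from `v` within radius `R` (in either
  instance), then `val t Φ w = val t Φ' w` for every `w` at co-occurrence distance `q` from `v` with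
  `q + t ≤ R` (strong induction on `t`);
* `sissW_local` — in particular `val R Φ v = val R Φ' v`.
No definitions (all objects are hypotheses); axioms `propext`, `Classical.choice`, `Quot.sound`.
-/

set_option linter.dupNamespace false -- `Summit.PneNP.PneNP.…`: summit = sub-problem (D-0017)

namespace Summit.PneNP.PneNP.Theorems

open Finset
open scoped Classical

section Local

variable {m k n : ℕ}

/-- **Locality of the two-way repair values, walk form.** If `Φ` and `Φ'` agree on every clause that
`v` sees within radius `R` (in either instance), then for every round `t`, every length `q` with
`q + t ≤ R` and every variable `w` reached from `v` by a co-occurrence walk of length `q` in `Φ`: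
`val t Φ w = val t Φ' w`. -/
theorem sissW_val_transfer (val : ℕ → (Fin m → Fin k → Fin n × Bool) → Fin n → Bool)
    (hval0 : ∀ (Φ : (Fin m → Fin k → Fin n × Bool)) (v : Fin n), val 0 Φ v = true)
    (hvalW : ∀ (t : ℕ) (Φ : (Fin m → Fin k → Fin n × Bool)) (v : Fin n), val (t + 1) Φ v = val t Φ v ↔
      ¬ (∃ ii : Fin m, (∀ jj : Fin k, val t Φ (Φ ii jj).1 ≠ (Φ ii jj).2) ∧
        ∃ jf : Fin k, (∀ j' : Fin k, (if 1 ≤ t ∧ val t Φ (Φ ii jf).1 ≠ val (t - 1) Φ (Φ ii jf).1 then (2 : ℕ)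
          else if (Φ ii jf).2 = true then 1 else 0) < (if 1 ≤ t ∧ val t Φ (Φ ii j').1 ≠ val (t - 1) Φ (Φ ii j').1 then (2 : ℕ)
          else if (Φ ii j').2 = true then 1 else 0) ∨
        ((if 1 ≤ t ∧ val t Φ (Φ ii jf).1 ≠ val (t - 1) Φ (Φ ii jf).1 then (2 : ℕ)
          else if (Φ ii jf).2 = true then 1 else 0) = (if 1 ≤ t ∧ val t Φ (Φ ii j').1 ≠ val (t - 1) Φ (Φ ii j').1 then (2 : ℕ)
          else if (Φ ii j').2 = true then 1 else 0) ∧ jf ≤ j')) ∧ (Φ ii jf).1 = v))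
    (R : ℕ) (Φ Φ' : (Fin m → Fin k → Fin n × Bool)) (v : Fin n)
    (H : ∀ i : Fin m,
      ((∃ j : Fin k, ∃ p : ℕ → Fin n, p 0 = v ∧ p R = (Φ i j).1 ∧ ∀ s, s < R → (p s = p (s + 1) ∨
          ∃ i' : Fin m, ∃ j₁ j₂ : Fin k, (Φ i' j₁).1 = p s ∧ (Φ i' j₂).1 = p (s + 1))) ∨
       (∃ j : Fin k, ∃ p : ℕ → Fin n, p 0 = v ∧ p R = (Φ' i j).1 ∧ ∀ s, s < R → (p s = p (s + 1) ∨
          ∃ i' : Fin m, ∃ j₁ j₂ : Fin k, (Φ' i' j₁).1 = p s ∧ (Φ' i' j₂).1 = p (s + 1)))) →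
      Φ i = Φ' i) :
    ∀ (t : ℕ) (w : Fin n) (q : ℕ), q + t ≤ R →
      (∃ p : ℕ → Fin n, p 0 = v ∧ p q = w ∧ ∀ s, s < q → (p s = p (s + 1) ∨
          ∃ i' : Fin m, ∃ j₁ j₂ : Fin k, (Φ i' j₁).1 = p s ∧ (Φ i' j₂).1 = p (s + 1))) →
      val t Φ w = val t Φ' w := by
  -- the symmetric agreement hypothesis
  have H' : ∀ i : Fin m,
      ((∃ j : Fin k, ∃ p : ℕ → Fin n, p 0 = v ∧ p R = (Φ' i j).1 ∧ ∀ s, s < R → (p s = p (s + 1) ∨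
          ∃ i' : Fin m, ∃ j₁ j₂ : Fin k, (Φ' i' j₁).1 = p s ∧ (Φ' i' j₂).1 = p (s + 1))) ∨
       (∃ j : Fin k, ∃ p : ℕ → Fin n, p 0 = v ∧ p R = (Φ i j).1 ∧ ∀ s, s < R → (p s = p (s + 1) ∨
          ∃ i' : Fin m, ∃ j₁ j₂ : Fin k, (Φ i' j₁).1 = p s ∧ (Φ i' j₂).1 = p (s + 1)))) →
      Φ' i = Φ i := fun i h => (H i h.symm).symm
  intro t
  induction t using Nat.strong_induction_on with
  | _ t ih =>
    intro w q hqt hreach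
    rcases Nat.eq_zero_or_pos t with rfl | htpos
    · rw [hval0, hval0]
    obtain ⟨t, rfl⟩ : ∃ t', t = t' + 1 := ⟨t - 1, by omega⟩
    obtain ⟨p, hp0, hpq, hpath⟩ := hreach
    -- a clause containing `w` (in either instance) agrees, and all its variables satisfy the IH at
    -- rounds `t` and `t - 1`
    have hclause : ∀ (i : Fin m) (jw : Fin k), ((Φ i jw).1 = w ∨ (Φ' i jw).1 = w) →
        Φ i = Φ' i ∧ (∀ j : Fin k, val t Φ (Φ i j).1 = val t Φ' (Φ i j).1) ∧
          ∀ j : Fin k, val (t - 1) Φ (Φ i j).1 = val (t - 1) Φ' (Φ i j).1 := by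
      intro i jw hw
      have hi : Φ i = Φ' i := by
        rcases hw with hw | hw
        · exact H i (Or.inl (sissR_sees_of_reach Φ v i jw q R (by omega) p hp0 (by rw [hpq, hw]) hpath))
        · refine (H' i (Or.inl (sissR_sees_of_reach Φ' v i jw q R (by omega) p hp0 (by rw [hpq, hw])
            fun s hs => ?_))).symm
          rcases hpath s hs with h | ⟨i', j₁, j₂, h₁, h₂⟩
          · exact Or.inl h
          · have hi' : Φ i' = Φ' i' :=
              H i' (Or.inl (sissR_sees_of_reach Φ v i' j₁ s R (by omega) p hp0 h₁.symm
                fun s' hs' => hpath s' (by omega)))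
            exact Or.inr ⟨i', j₁, j₂, by rw [← hi']; exact h₁, by rw [← hi']; exact h₂⟩
      have hwi : (Φ i jw).1 = w := by
        rcases hw with hw | hw
        · exact hw
        · rw [hi]; exact hw
      -- the walk extended by one step inside clause `i`
      have hreach' : ∀ j : Fin k, ∃ p' : ℕ → Fin n, p' 0 = v ∧ p' (q + 1) = (Φ i j).1 ∧
          ∀ s, s < q + 1 → (p' s = p' (s + 1) ∨
            ∃ i' : Fin m, ∃ j₁ j₂ : Fin k, (Φ i' j₁).1 = p' s ∧ (Φ i' j₂).1 = p' (s + 1)) := by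
        intro j
        refine ⟨fun s => if s ≤ q then p s else (Φ i j).1, by
            dsimp only; rw [if_pos (Nat.zero_le q), hp0], by dsimp only; rw [if_neg (by omega)], ?_⟩
        intro s hs
        dsimp only
        rcases Nat.lt_or_ge s q with hsq | hsq
        · rw [if_pos hsq.le, if_pos (Nat.succ_le_of_lt hsq)]
          exact hpath s hsq
        · have hs' : s = q := by omega
          subst hs'
          right
          refine ⟨i, jw, j, ?_, ?_⟩
          · rw [if_pos le_rfl, hpq]; exact hwi
          · rw [if_neg (by omega)]
      exact ⟨hi, fun j => ih t (Nat.lt_succ_self t) (Φ i j).1 (q + 1) (by omega) (hreach' j),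
        fun j => ih (t - 1) (by omega) (Φ i j).1 (q + 1) (by omega) (hreach' j)⟩
    -- the flip events at `w` agree
    have hflip : ((∃ ii : Fin m, (∀ jj : Fin k, val t Φ (Φ ii jj).1 ≠ (Φ ii jj).2) ∧
        ∃ jf : Fin k, (∀ j' : Fin k, (if 1 ≤ t ∧ val t Φ (Φ ii jf).1 ≠ val (t - 1) Φ (Φ ii jf).1 then (2 : ℕ)
          else if (Φ ii jf).2 = true then 1 else 0) < (if 1 ≤ t ∧ val t Φ (Φ ii j').1 ≠ val (t - 1) Φ (Φ ii j').1 then (2 : ℕ)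
          else if (Φ ii j').2 = true then 1 else 0) ∨
        ((if 1 ≤ t ∧ val t Φ (Φ ii jf).1 ≠ val (t - 1) Φ (Φ ii jf).1 then (2 : ℕ)
          else if (Φ ii jf).2 = true then 1 else 0) = (if 1 ≤ t ∧ val t Φ (Φ ii j').1 ≠ val (t - 1) Φ (Φ ii j').1 then (2 : ℕ)
          else if (Φ ii j').2 = true then 1 else 0) ∧ jf ≤ j')) ∧ (Φ ii jf).1 = w)) ↔ ((∃ ii : Fin m, (∀ jj : Fin k, val t Φ' (Φ' ii jj).1 ≠ (Φ' ii jj).2) ∧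
        ∃ jf : Fin k, (∀ j' : Fin k, (if 1 ≤ t ∧ val t Φ' (Φ' ii jf).1 ≠ val (t - 1) Φ' (Φ' ii jf).1 then (2 : ℕ)
          else if (Φ' ii jf).2 = true then 1 else 0) < (if 1 ≤ t ∧ val t Φ' (Φ' ii j').1 ≠ val (t - 1) Φ' (Φ' ii j').1 then (2 : ℕ)
          else if (Φ' ii j').2 = true then 1 else 0) ∨
        ((if 1 ≤ t ∧ val t Φ' (Φ' ii jf).1 ≠ val (t - 1) Φ' (Φ' ii jf).1 then (2 : ℕ)
          else if (Φ' ii jf).2 = true then 1 else 0) = (if 1 ≤ t ∧ val t Φ' (Φ' ii j').1 ≠ val (t - 1) Φ' (Φ' ii j').1 then (2 : ℕ)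
          else if (Φ' ii j').2 = true then 1 else 0) ∧ jf ≤ j')) ∧ (Φ' ii jf).1 = w)) := by
      constructor
      · rintro ⟨i, hviol, jn, hnom, hvar⟩
        obtain ⟨hi, hvals, hvals'⟩ := hclause i jn (Or.inl hvar)
        have e1 : Φ' i = Φ i := hi.symm
        refine ⟨i, fun jj => ?_, jn, fun jx => ?_, by rw [e1]; exact hvar⟩
        · rw [e1, ← hvals jj]
          exact hviol jj
        · have := hnom jx
          simp only [e1, ← hvals, ← hvals']
          exact this
      · rintro ⟨i, hviol, jn, hnom, hvar⟩
        obtain ⟨hi, hvals, hvals'⟩ := hclause i jn (Or.inr hvar)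
        have e1 : Φ' i = Φ i := hi.symm
        refine ⟨i, fun jj => ?_, jn, fun jx => ?_, by rw [← e1]; exact hvar⟩
        · rw [hvals jj, ← e1]
          exact hviol jj
        · have := hnom jx
          simp only [e1, ← hvals, ← hvals'] at this
          exact this
    have hval : val t Φ w = val t Φ' w := ih t (Nat.lt_succ_self t) w q (by omega) ⟨p, hp0, hpq, hpath⟩
    -- conclude through the step specification
    by_cases hf : (∃ ii : Fin m, (∀ jj : Fin k, val t Φ (Φ ii jj).1 ≠ (Φ ii jj).2) ∧
        ∃ jf : Fin k, (∀ j' : Fin k, (if 1 ≤ t ∧ val t Φ (Φ ii jf).1 ≠ val (t - 1) Φ (Φ ii jf).1 then (2 : ℕ)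
          else if (Φ ii jf).2 = true then 1 else 0) < (if 1 ≤ t ∧ val t Φ (Φ ii j').1 ≠ val (t - 1) Φ (Φ ii j').1 then (2 : ℕ)
          else if (Φ ii j').2 = true then 1 else 0) ∨
        ((if 1 ≤ t ∧ val t Φ (Φ ii jf).1 ≠ val (t - 1) Φ (Φ ii jf).1 then (2 : ℕ)
          else if (Φ ii jf).2 = true then 1 else 0) = (if 1 ≤ t ∧ val t Φ (Φ ii j').1 ≠ val (t - 1) Φ (Φ ii j').1 then (2 : ℕ)
          else if (Φ ii j').2 = true then 1 else 0) ∧ jf ≤ j')) ∧ (Φ ii jf).1 = w)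
    · rw [sissW_flip_ne val hvalW t Φ w hf, sissW_flip_ne val hvalW t Φ' w (hflip.1 hf), hval]
    · rw [sissW_noflip_eq val hvalW t Φ w hf, sissW_noflip_eq val hvalW t Φ' w (fun h => hf (hflip.2 h)),
        hval]

/-- **The two-way repair section is a radius-`R` local rule.** If `Φ` and `Φ'` agree on every clause
that `v` sees within radius `R` (hypothesis shape `hloc` of `shwRad_hamming_le`), then
`val R Φ v = val R Φ' v`. -/
theorem sissW_local (val : ℕ → (Fin m → Fin k → Fin n × Bool) → Fin n → Bool)
    (hval0 : ∀ (Φ : (Fin m → Fin k → Fin n × Bool)) (v : Fin n), val 0 Φ v = true)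
    (hvalW : ∀ (t : ℕ) (Φ : (Fin m → Fin k → Fin n × Bool)) (v : Fin n), val (t + 1) Φ v = val t Φ v ↔
      ¬ (∃ ii : Fin m, (∀ jj : Fin k, val t Φ (Φ ii jj).1 ≠ (Φ ii jj).2) ∧
        ∃ jf : Fin k, (∀ j' : Fin k, (if 1 ≤ t ∧ val t Φ (Φ ii jf).1 ≠ val (t - 1) Φ (Φ ii jf).1 then (2 : ℕ)
          else if (Φ ii jf).2 = true then 1 else 0) < (if 1 ≤ t ∧ val t Φ (Φ ii j').1 ≠ val (t - 1) Φ (Φ ii j').1 then (2 : ℕ)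
          else if (Φ ii j').2 = true then 1 else 0) ∨
        ((if 1 ≤ t ∧ val t Φ (Φ ii jf).1 ≠ val (t - 1) Φ (Φ ii jf).1 then (2 : ℕ)
          else if (Φ ii jf).2 = true then 1 else 0) = (if 1 ≤ t ∧ val t Φ (Φ ii j').1 ≠ val (t - 1) Φ (Φ ii j').1 then (2 : ℕ)
          else if (Φ ii j').2 = true then 1 else 0) ∧ jf ≤ j')) ∧ (Φ ii jf).1 = v))
    (R : ℕ) (Φ Φ' : (Fin m → Fin k → Fin n × Bool)) (v : Fin n)
    (H : ∀ i : Fin m,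
      ((∃ j : Fin k, ∃ p : ℕ → Fin n, p 0 = v ∧ p R = (Φ i j).1 ∧ ∀ s, s < R → (p s = p (s + 1) ∨
          ∃ i' : Fin m, ∃ j₁ j₂ : Fin k, (Φ i' j₁).1 = p s ∧ (Φ i' j₂).1 = p (s + 1))) ∨
       (∃ j : Fin k, ∃ p : ℕ → Fin n, p 0 = v ∧ p R = (Φ' i j).1 ∧ ∀ s, s < R → (p s = p (s + 1) ∨
          ∃ i' : Fin m, ∃ j₁ j₂ : Fin k, (Φ' i' j₁).1 = p s ∧ (Φ' i' j₂).1 = p (s + 1)))) →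
      Φ i = Φ' i) :
    val R Φ v = val R Φ' v :=
  sissW_val_transfer val hval0 hvalW R Φ Φ' v H R v 0 (by omega)
    ⟨fun _ => v, rfl, rfl, fun s hs => absurd hs (Nat.not_lt_zero s)⟩

end Local

end Summit.PneNP.PneNP.Theorems
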